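/-
Copyright (c) 2026 the pub-hodgecm-mathlib formalisation cell (harness21).  Prover seat hodgecm-mathlib-K2E4-p09 (g3), Track B «K2-LIT» ∕ h413, road J ∕ letter ‹J3› at a
DYADIC RAMIFIED place, road (d-w) brick (L) «LIE GRAM NUMBERS AT A WILD PLACE», KIT (dealer K2E3-plan (g2) (D39), road (d-w) owner K2E3-p03 (g3)): the skew line of `L_w`
through an anti-fixed generator at ANY ramified place — wild places included.  2026-09-04.
-/
import Literature.NumberTheory.Weil1982.UnitaryFinTopFormLieGramRamifiedKit   -- ★ R3c-ram PART 1 (K2E3-p03 (g2)): the tame kit; brings ★ `RamifiedPlaceOrderAdditiveIndex`, `RamifiedPlaceEisensteinBasis`, `LocalFields` balls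
import HarnessLib

/-!
# (L) KIT — THE SKEW LINE THROUGH AN ANTI-FIXED GENERATOR AT ANY RAMIFIED PLACE (tame OR wild):
# `{skew} = ι(L⁺_v)·α`, skew integral elements have `|·| ≤ exp(−s)`, `[{|x| ≤ exp n} : 𝒪_w] = q^n`, `[{skew, ≤ exp(2(j+k) − s)} : {skew, ≤ exp(2j − s)}] = q^k`
# (Serre, *Local Fields* II §3 Prop. 5, IV §1–2; Jacobowitz 1962 §§5, 9)

Topic `NumberTheory/Weil1982`; namespace `Literature.NumberTheory.Weil1982.UnitaryFinTopForm` (continues ★ R3c-ram PART 1 `UnitaryFinTopFormLieGramRamifiedKit` of K2E3-p03 (g2),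
whose skew-ball index `relIndex_skewBall_one_skewBall_exp_one` is keyed on a skew UNIFORMISER `ϖ` with `|σϖ − ϖ| = exp(−1)` — a TAME datum; this file re-keys it on an arbitrary
anti-fixed generator).  THEOREMS ONLY (no definition, no instance, no notation, no axiom, no named fact, no `sorry`); kernel lane `--kind proof --supports stmt-HodgeConjecture-24833`
(count-neutral).  Cell `pub/hodgecm-mathlib`, crux H413 (`stmt-HodgeConjecture-24833`), Track B «K2-LIT», road J of ‹S› `sig_K2E3SingularTransferSigned`, letter ‹J3›
`sig_K2E3CompatibleMeasureEPIdentityRankOne` (v2), leaf **(J3d-w)** `U3bCentralGermsLeaves.sig_K2E3CompatibleMeasureEPIdentityRankOneDyadicRamified` (a DYADIC RAMIFIED place: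
`2 ∈ v`, `e(w|v) = 2`); road (d-w) (K2E3-p03 (g3) `CENSUS-J3dw` fd3c4f7e §2 (L), §3), brick **(L) «LIE GRAM NUMBERS AT A WILD PLACE»**: FILE 1 `UnitaryFinTopFormLieGramWildRankTwo`
(`V₀(𝔲(Φ₂))`) and FILE 2 `UnitaryFinTopFormLieGramWildAnisotropic` (`V₀(𝔲(⟨1,−ξ⟩))`) count their trace duals one coordinate at a time with THIS kit.

THE MATHEMATICS (`q = #(𝓞_{L⁺}∕𝔭_v) = #𝓀_w`, `σ = σ_w`, `ι = toPlace v w`, `e(w|v) = 2`; NO hypothesis on the residue characteristic).  By the anti-fixed dichotomy (★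
`exists_units_galAdicCompletionMap_complexConj_eq_neg_of_ramified`) there is `α ∈ L_w` with `σα = −α` and `|α|_w = exp(−s)`, `s ∈ {0, 1}` (`s = 1`: `√π`-type, every tame place;
`s = 0`: `√u`-type, wild only).  Since `σ` has the fixed field `ι(L⁺_v)` (★ `exists_toPlace_eq_of_galAdicCompletionMap_eq`), **the skew line is `ι(L⁺_v)·α`**
(`exists_toPlace_mul_eq_of_skew`), and `|ι(c)·α|_w = |c|_v²·exp(−s)` (★ `valued_toPlace_eq_sq_of_ramified`) has exponent `≡ −s (mod 2)`; hence a skew element with `|x| ≤ exp(2j)`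
has `|x| ≤ exp(2j − s)` (`valued_le_of_skew_of_le_exp_even_of_antifixed`; `j = 0`: the skew INTEGRAL elements are `ι(𝒪_v)·α`), and `× α⁻¹` carries the skew ball
`{skew, ≤ exp(2j − s)}` onto `ι({|c|_v ≤ exp j})`, so **`[{skew, ≤ exp(2(j+k) − s)} : {skew, ≤ exp(2j − s)}] = [𝔭_v^{−(j+k)} : 𝔭_v^{−j}] = q^k`**
(`relIndex_skewBall_eq_pow_of_antifixed`; ★ `LocalFields.relIndex_ball_eq_pow` over `L⁺_v`).  The `𝒪_w`-line: `[{|x| ≤ exp n} : 𝒪_w] = q^n` (`relIndex_ball_le_one_ball_le_exp`, ★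
`relIndex_valued_le_eq_pow`, `f(w|v) = 1`).  At a tame place (`α = ϖ`, `s = 1`) these are ★ PART 1's `valued_le_of_skew_of_le_even`, `relIndex_skewBall_one_skewBall_exp_one`,
`relIndex_ball_one_ball_exp_one`.
HONEST LABEL: count-neutral local algebra toward ‹J3› (d-w); HC_CM is proved only modulo the 7 printed citations (2 remaining named inputs: hLiu418 = `stmt-HodgeConjecture-24832`,
h413 = `stmt-HodgeConjecture-24833`) until rung 0 closes.

## References
* [Serre1979] J.-P. Serre, *Local Fields*, GTM 67 (1979), Ch. II §3 Prop. 5 (the filtration `𝔭ⁿ` and its indices), Ch. IV §1 Prop. 4, §2 (`e = 2`; the wild quadratic case).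
* [Jacobowitz1962] R. Jacobowitz, Hermitian forms over local fields, Amer. J. Math. 84 (1962), §5 (ramified non-dyadic: `π̄ = −π`), §§9–11 (ramified dyadic: `F(√u)` ∕ `F(√π)`).
* [Weil1982] A. Weil, *Adeles and Algebraic Groups*, Progress in Math. 23 (1982), Ch. II §2.2 (lattices and their indices in the volume computation).
-/

set_option autoImplicit false

noncomputable section

open NumberField IsDedekindDomain IsLocalRing Matrix
open Literature.NumberTheory.Automorphic Literature.NumberTheory.Automorphic.UnitaryGroup
open scoped MatrixGroups Matrix NNReal Valued WithZero

namespace Literature.NumberTheory.Weil1982.UnitaryFinTopForm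

/-! ## §1 The skew line through an anti-fixed generator `α` (any ramified place) -/

section SkewLine

variable (L : Type) [Field L] [NumberField L] [IsCMField L] (v : HeightOneSpectrum (𝓞 ↥(maximalRealSubfield L)))
  (w : PlacesOver L v) (hw : IsCMField.complexConj L • w.1 = w.1) (he : v.asIdeal.ramificationIdx' w.1.asIdeal ≠ 1)

include hw in
/-- **The skew line is `ι(L⁺_v)·α`**: if `σα = −α`, `α ≠ 0`, and `σx = −x`, then `x = ι(c)·α` for some `c ∈ L⁺_v` (`x∕α` is `σ`-fixed, hence descends — ★
`exists_toPlace_eq_of_galAdicCompletionMap_eq`). [cite: Serre1979, Ch. IV §2] [cite: Jacobowitz1962, §9] -/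
theorem exists_toPlace_mul_eq_of_skew {α : w.1.adicCompletion L} (hσα : galAdicCompletionMap (L := L) (IsCMField.complexConj L) hw α = -α) (hα0 : α ≠ 0)
    {x : w.1.adicCompletion L} (hx : galAdicCompletionMap (L := L) (IsCMField.complexConj L) hw x = -x) :
    ∃ c : v.adicCompletion ↥(maximalRealSubfield L), toPlace v w c * α = x := by
  have hc1 : IsCMField.complexConj L ≠ 1 := IsCMField.complexConj_ne_one L
  obtain ⟨c, hc⟩ := exists_toPlace_eq_of_galAdicCompletionMap_eq (IsCMField.complexConj L) w hc1 hw (x / α) (by rw [map_div₀, hx, hσα, neg_div_neg_eq])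
  exact ⟨c, by rw [hc, div_mul_cancel₀ _ hα0]⟩

omit [IsCMField L] in
/-- **Squares have even exponent** in `ℤᵐ⁰`: `y² ≤ exp(2j + r) ↔ y ≤ exp j` for `r ∈ {0, 1}` (valuation bookkeeping for `|ι c|_w = |c|_v²`). [cite: Serre1979, Ch. II §3] -/
theorem withZero_sq_le_exp_iff (y : ℤᵐ⁰) (j : ℤ) (r : ℕ) (hr : r ≤ 1) : y ^ 2 ≤ WithZero.exp (2 * j + r) ↔ y ≤ WithZero.exp j := by
  rcases eq_or_ne y 0 with rfl | hy
  · simp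
  obtain ⟨k, hk⟩ : ∃ k : ℤ, y = WithZero.exp k := ⟨_, (WithZero.exp_log hy).symm⟩
  rw [hk, ← WithZero.exp_nsmul, WithZero.exp_le_exp, WithZero.exp_le_exp]
  simp only [nsmul_eq_mul, Nat.cast_ofNat]
  omega

omit [IsCMField L] in
/-- Valuation bookkeeping in `ℤᵐ⁰`: `x · exp e ≤ exp f ↔ x ≤ exp (f − e)`. [cite: Serre1979, Ch. II §3] -/
theorem withZero_mul_exp_le_exp_iff (x : ℤᵐ⁰) (e f : ℤ) : x * WithZero.exp e ≤ WithZero.exp f ↔ x ≤ WithZero.exp (f - e) := by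
  rw [← mul_le_mul_iff_of_pos_right (show (0 : ℤᵐ⁰) < WithZero.exp (-e) from WithZero.exp_pos), mul_assoc, ← WithZero.exp_add, ← WithZero.exp_add,
    add_neg_cancel, WithZero.exp_zero, mul_one, ← sub_eq_add_neg]

omit [IsCMField L] in
/-- Valuation bookkeeping in `ℤᵐ⁰`: `x · exp e ≤ 1 ↔ x ≤ exp (−e)`. [cite: Serre1979, Ch. II §3] -/
theorem withZero_mul_exp_le_one_iff (x : ℤᵐ⁰) (e : ℤ) : x * WithZero.exp e ≤ 1 ↔ x ≤ WithZero.exp (-e) := by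
  rw [← WithZero.exp_zero, withZero_mul_exp_le_exp_iff, zero_sub]

include hw he in
/-- **Skew elements have valuation `≡ −s (mod 2)`**: if `σα = −α`, `|α| = exp(−s)` (`s ≤ 1`), `σx = −x` and `|x| ≤ exp(2j)`, then `|x| ≤ exp(2j − s)` — because
`x = ι(c)·α` and `|ι c|_w = |c|_v²` is an even power (★ `valued_toPlace_eq_sq_of_ramified`).  At a tame place (`α = ϖ`, `s = 1`) this is ★ `valued_le_of_skew_of_le_even`.
[cite: Serre1979, Ch. II §3, Ch. IV §2] [cite: Jacobowitz1962, §§5, 9] -/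
theorem valued_le_of_skew_of_le_exp_even_of_antifixed {α : w.1.adicCompletion L} (hσα : galAdicCompletionMap (L := L) (IsCMField.complexConj L) hw α = -α)
    {s : ℕ} (hs : s ≤ 1) (hα : Valued.v α = WithZero.exp (-(s : ℤ)))
    {x : w.1.adicCompletion L} (hx : galAdicCompletionMap (L := L) (IsCMField.complexConj L) hw x = -x) (j : ℤ) (hxj : Valued.v x ≤ WithZero.exp (2 * j)) :
    Valued.v x ≤ WithZero.exp (2 * j - s) := by
  have hα0 : α ≠ 0 := fun h0 => by rw [h0, map_zero] at hα; exact WithZero.zero_ne_coe hα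
  obtain ⟨c, rfl⟩ := exists_toPlace_mul_eq_of_skew L v w hw hσα hα0 hx
  rw [map_mul, valued_toPlace_eq_sq_of_ramified L v w hw he, hα] at hxj ⊢
  have hc : Valued.v c ^ 2 ≤ WithZero.exp (2 * j + s) := by
    rw [withZero_mul_exp_le_exp_iff, sub_neg_eq_add] at hxj; exact hxj
  have hc' : Valued.v c ≤ WithZero.exp j := (withZero_sq_le_exp_iff (Valued.v c) j s hs).1 hc
  rw [withZero_mul_exp_le_exp_iff, show (2 * j - (s : ℤ) - -(s : ℤ)) = 2 • j by rw [nsmul_eq_mul]; push_cast; ring, WithZero.exp_nsmul]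
  exact pow_le_pow_left₀ zero_le hc' 2

omit [IsCMField L] in
/-- **Balls of `L⁺_v` are additive subgroups**: `∃ C, c ∈ C ↔ |c|_v ≤ r`. [cite: Serre1979, Ch. II §3] -/
private theorem exists_addSubgroup_baseBall (r : WithZero (Multiplicative ℤ)) :
    ∃ C : AddSubgroup (v.adicCompletion ↥(maximalRealSubfield L)), ∀ c, c ∈ C ↔ Valued.v c ≤ r := by
  refine ⟨{ carrier := {c | Valued.v c ≤ r}
            add_mem' := fun {a b} ha hb => by
              simp only [Set.mem_setOf_eq] at ha hb ⊢
              exact (Valuation.map_add _ a b).trans (max_le ha hb)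
            zero_mem' := by simp
            neg_mem' := fun {a} ha => by simpa only [Set.mem_setOf_eq, Valuation.map_neg] using ha }, fun _ => Iff.rfl⟩

omit [IsCMField L] in
/-- **`[𝔭_v^{e} : 𝔭_v^{e+k}] = q^k`** in `L⁺_v` (★ `LocalFields.relIndex_ball_eq_pow`, `n = 1`, transported along `(Fin 1 → L⁺_v) →+ L⁺_v`). [cite: Serre1979, Ch. II §3 Prop. 5] -/
private theorem relIndex_baseBall_eq_pow (e : ℤ) (k : ℕ) (C C' : AddSubgroup (v.adicCompletion ↥(maximalRealSubfield L)))
    (hC : ∀ c, c ∈ C ↔ Valued.v c ≤ WithZero.exp (-(e + k))) (hC' : ∀ c, c ∈ C' ↔ Valued.v c ≤ WithZero.exp (-e)) :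
    C.relIndex C' = Nat.card (𝓞 ↥(maximalRealSubfield L) ⧸ v.asIdeal) ^ k := by
  classical
  obtain ⟨B, hB⟩ := LocalFields.exists_addSubgroup_ball ↥(maximalRealSubfield L) v (n := 1) (fun _ => e + k)
  obtain ⟨B', hB'⟩ := LocalFields.exists_addSubgroup_ball ↥(maximalRealSubfield L) v (n := 1) (fun _ => e)
  have hidx := LocalFields.relIndex_ball_eq_pow ↥(maximalRealSubfield L) v (n := 1) (fun _ => e) (fun _ => k) B B' hB hB'
  simp only [Finset.univ_unique, Fin.default_eq_zero, Finset.sum_singleton] at hidx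
  let φ : (Fin 1 → v.adicCompletion ↥(maximalRealSubfield L)) →+ v.adicCompletion ↥(maximalRealSubfield L) :=
    Pi.evalAddMonoidHom (fun _ => v.adicCompletion ↥(maximalRealSubfield L)) 0
  have hφ : ∀ g : Fin 1 → v.adicCompletion ↥(maximalRealSubfield L), φ g = g 0 := fun _ => rfl
  have hcomap : C.comap φ = B := by
    ext g
    rw [AddSubgroup.mem_comap, hC, hB, hφ]
    constructor
    · intro h i; rw [Subsingleton.elim i 0]; exact h
    · intro h; exact h 0
  have hmap : B'.map φ = C' := by
    ext x
    rw [AddSubgroup.mem_map, hC']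
    constructor
    · rintro ⟨g, hg, rfl⟩; rw [hφ]; exact (hB' g).1 hg 0
    · intro hx; exact ⟨fun _ => x, (hB' _).2 fun _ => hx, rfl⟩
  rw [← hidx, ← hcomap, AddSubgroup.relIndex_comap, hmap]

include hw he in
/-- **`[{|x| ≤ exp n} : 𝒪_w] = q^n`** in `L_w` at a ramified place (`f(w|v) = 1`; ★ `relIndex_valued_le_eq_pow`). [cite: Serre1979, Ch. II §3 Prop. 5, Ch. III §3] -/
theorem relIndex_ball_le_one_ball_le_exp (n : ℕ) (B B' : AddSubgroup (w.1.adicCompletion L))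
    (hB : ∀ x, x ∈ B ↔ Valued.v x ≤ 1) (hB' : ∀ x, x ∈ B' ↔ Valued.v x ≤ WithZero.exp (n : ℤ)) :
    B.relIndex B' = Nat.card (𝓞 ↥(maximalRealSubfield L) ⧸ v.asIdeal) ^ n :=
  relIndex_valued_le_eq_pow L v w hw he (-(n : ℤ)) n B B' (fun x => by rw [hB x, neg_add_cancel, neg_zero, WithZero.exp_zero]) (fun x => by rw [hB' x, neg_neg])

include hw he in
/-- **THE SKEW BALLS `{skew, |b| ≤ exp(2(j+k) − s)} ⊇ {skew, |b| ≤ exp(2j − s)}` HAVE INDEX `q^k`** (`σα = −α`, `|α| = exp(−s)`): multiplication by `α⁻¹` carries them onto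
the `σ`-fixed balls `ι({|c|_v ≤ exp(j+k)}) ⊇ ι({|c|_v ≤ exp j})` (`|ι(c)·α|_w = |c|_v²·exp(−s)`; a fixed element descends, ★ `exists_toPlace_eq_of_galAdicCompletionMap_eq`), whose
index is `q^k` in `L⁺_v`.  At a tame place (`α = ϖ`, `s = 1`, `j = 0, 1`) this is ★ PART 1 `relIndex_skewBall_one_skewBall_exp_one`. [cite: Serre1979, Ch. II §3 Prop. 5, Ch. IV §2]
[cite: Jacobowitz1962, §9] -/
theorem relIndex_skewBall_eq_pow_of_antifixed {α : w.1.adicCompletion L} (hσα : galAdicCompletionMap (L := L) (IsCMField.complexConj L) hw α = -α)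
    {s : ℕ} (hα : Valued.v α = WithZero.exp (-(s : ℤ))) (j : ℤ) (k : ℕ)
    (T T' : AddSubgroup (w.1.adicCompletion L))
    (hT : ∀ x, x ∈ T ↔ galAdicCompletionMap (L := L) (IsCMField.complexConj L) hw x = -x ∧ Valued.v x ≤ WithZero.exp (2 * j - s))
    (hT' : ∀ x, x ∈ T' ↔ galAdicCompletionMap (L := L) (IsCMField.complexConj L) hw x = -x ∧ Valued.v x ≤ WithZero.exp (2 * (j + k) - s)) :
    T.relIndex T' = Nat.card (𝓞 ↥(maximalRealSubfield L) ⧸ v.asIdeal) ^ k := by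
  classical
  have hα0 : α ≠ 0 := fun h0 => by rw [h0, map_zero] at hα; exact WithZero.zero_ne_coe hα
  -- multiplication by `α⁻¹` and the embedding `ι`
  let μ : w.1.adicCompletion L →+ w.1.adicCompletion L := AddMonoidHom.mulRight α⁻¹
  have hμ : ∀ x, μ x = x * α⁻¹ := fun _ => rfl
  have hμinj : Function.Injective μ := fun x y h => mul_right_cancel₀ (inv_ne_zero hα0) (by rw [← hμ, ← hμ]; exact h)
  let ι : v.adicCompletion ↥(maximalRealSubfield L) →+ w.1.adicCompletion L := (toPlace v w).toAddMonoidHom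
  have hι : ∀ c, ι c = toPlace v w c := fun _ => rfl
  have hιinj : Function.Injective ι := (toPlace v w).injective
  obtain ⟨C, hC⟩ := exists_addSubgroup_baseBall L v (WithZero.exp (-((-(j + k) : ℤ) + (k : ℤ))))
  obtain ⟨C', hC'⟩ := exists_addSubgroup_baseBall L v (WithZero.exp (-(-(j + k) : ℤ)))
  -- scalar facts
  have hskew : ∀ c : v.adicCompletion ↥(maximalRealSubfield L),
      galAdicCompletionMap (L := L) (IsCMField.complexConj L) hw (toPlace v w c * α) = -(toPlace v w c * α) := fun c => by
    rw [map_mul, galAdicCompletionMap_toPlace (IsCMField.complexConj L) w w hw c, hσα, mul_neg]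
  have hval : ∀ c : v.adicCompletion ↥(maximalRealSubfield L), Valued.v (toPlace v w c * α) = Valued.v c ^ 2 * WithZero.exp (-(s : ℤ)) := fun c => by
    rw [map_mul, valued_toPlace_eq_sq_of_ramified L v w hw he, hα]
  have hiff : ∀ (c : v.adicCompletion ↥(maximalRealSubfield L)) (i : ℤ), Valued.v (toPlace v w c * α) ≤ WithZero.exp (2 * i - s) ↔ Valued.v c ≤ WithZero.exp i := by
    intro c i
    rw [hval, withZero_mul_exp_le_exp_iff, show (2 * i - (s : ℤ) - -(s : ℤ)) = 2 * i + ((0 : ℕ) : ℤ) by push_cast; ring, withZero_sq_le_exp_iff (Valued.v c) i 0 zero_le_one]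
  -- `μ(T) = ι(C)` and `μ(T′) = ι(C′)`
  have hmapT : ∀ (S : AddSubgroup (w.1.adicCompletion L)) (E : AddSubgroup (v.adicCompletion ↥(maximalRealSubfield L))) (i : ℤ),
      (∀ x, x ∈ S ↔ galAdicCompletionMap (L := L) (IsCMField.complexConj L) hw x = -x ∧ Valued.v x ≤ WithZero.exp (2 * i - s)) →
      (∀ c, c ∈ E ↔ Valued.v c ≤ WithZero.exp i) → S.map μ = E.map ι := by
    intro S E i hS hE
    ext y
    rw [AddSubgroup.mem_map, AddSubgroup.mem_map]
    constructor
    · rintro ⟨x, hx, rfl⟩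
      obtain ⟨hxσ, hxv⟩ := (hS x).1 hx
      obtain ⟨c, rfl⟩ := exists_toPlace_mul_eq_of_skew L v w hw hσα hα0 hxσ
      exact ⟨c, (hE c).2 ((hiff c i).1 hxv), by rw [hι, hμ, mul_inv_cancel_right₀ hα0]⟩
    · rintro ⟨c, hc, rfl⟩
      exact ⟨toPlace v w c * α, (hS _).2 ⟨hskew c, (hiff c i).2 ((hE c).1 hc)⟩, by rw [hμ, mul_inv_cancel_right₀ hα0, hι]⟩
  have hmap1 : T.map μ = C.map ι := hmapT T C j hT (fun c => by rw [hC c, show (-(-(j + (k : ℤ)) + (k : ℤ))) = j by ring])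
  have hmap2 : T'.map μ = C'.map ι := hmapT T' C' (j + k) hT' (fun c => by rw [hC' c, neg_neg])
  rw [← AddSubgroup.relIndex_map_map_of_injective T T' hμinj, hmap1, hmap2, AddSubgroup.relIndex_map_map_of_injective C C' hιinj,
    relIndex_baseBall_eq_pow L v (-(j + k)) k C C' hC hC']

end SkewLine


end Literature.NumberTheory.Weil1982.UnitaryFinTopForm

end
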